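import Summits.Parity.GeneralizedHardyLittlewood.Theorems.BeyondDiagonalBeatsQuarter.OffDiagDualTruncationBound
import HarnessLib

/-!
# Route `PrimeLevelFamEdge`, crux K_B (stmt-Parity-20343), line `diagonal_kernel_split` rev 4, plan Ω,
# lemma **L2 `OffDiagDualTruncation`** (part 1d): the lattice tails from PURE derivative costs only

`OffDiagDualTruncationTails` controls the `h₁`-tail of `Σ_h ‖Φ̂(h/c)‖` by `A_k = ∫∫|∂₁ᵏΦ|` and the MIXED cost
`B_k = ∫∫|∂₁ᵏ∂₂²Φ|`. For the box weights of d5 the pure costs are in the tree (`OffDiagDualCostBoxIntegral`: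
`∫∫|∂₁ᵏΦ_i| ≤ S·Dᵏ`, and in `t₂` by the symmetry of the box weight), while mixed costs would need a further
Leibniz expansion. This file removes the mixed cost: for `h₁, h₂ ≠ 0` the two PURE bounds
`‖Φ̂‖ ≤ P₁ = (c/2π|h₁|)^{2k}·A¹_{2k}` and `‖Φ̂‖ ≤ P₂ = (c/2π|h₂|)⁴·A²₄` combine to `‖Φ̂‖ ≤ √(P₁P₂)`, which decays like
`|h₁|^{−k}|h₂|^{−2}`:

* `norm_fourier2_lattice_le_pure` — the pointwise bound (`min ≤ geometric mean`);
* **`sum_tail_norm_fourier2_le_pure`** / `tsum_tail_norm_fourier2_le_pure` — for `c > 0`, `k ≥ 2`, `H ≥ 1`: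
  `Σ_{|h₁| > H} ‖Φ̂(h₁/c,h₂/c)‖ ≤ 2·((c/2π)ᵏA¹_k + (π²/3)(c/2π)^{k+2}√(A¹_{2k}·A²₄))·H^{1−k}`,
  `A¹_m = ∫dt₂∫dt₁|∂₁ᵐΦ|`, `A²₄ = ∫dt₁∫dt₂|∂₂⁴Φ|`;
* **`tsum_tail_norm_fourier2_le_pure_of_cost`** — with `A¹_k ≤ S₁D₁ᵏ`, `A¹_{2k} ≤ S₁'D₁^{2k}`, `A²₄ ≤ S₂D₂⁴`,
  dual lengths `H_j = cD_j/(2π)`, loss `Q ≥ 1` and `H ≥ H₁Q`: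
  tail `≤ 2·(S₁ + (π²/3)·H₂²·√(S₁'S₂))·H·Q^{−k}` — the BLUEPRINT L2 truncation with pure costs only.

Folklore, PROVED; theorems only. Helper; closes nothing.
«The programme SEARCHES and TYPES; no claim about Landau–Siegel zeros, Theorems 1–2 of arXiv:2211.02515 or
a repaired Margin232 until a kernel theorem says so.»
-/

noncomputable section

open Real MeasureTheory Complex Finset Set
open scoped FourierTransform Topology ContDiff

namespace Summit.Parity.GeneralizedHardyLittlewood.Theorems.BeyondDiagonalBeatsQuarter.OffDiagPoissonTwisted

open Literature.NumberTheory.Sieve.FriedlanderIwaniecPrimes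

section Pure

variable {Φ : ℝ → ℝ → ℂ}

/-- **Pointwise dual bound from pure derivatives** (`h₁ ≠ 0`, `c > 0`): `‖Φ̂(h₁/c,h₂/c)‖ ≤ (|h₁|ᵏ)⁻¹·w(h₂)` with
`w(0) = (c/2π)ᵏA¹_k` and `w(h₂) = (c/2π)^{k+2}√(A¹_{2k}A²₄)·(h₂²)⁻¹` for `h₂ ≠ 0`. [folklore] -/
theorem norm_fourier2_lattice_le_pure (hΦ : ContDiff ℝ ∞ (Function.uncurry Φ))
    (hΦc : HasCompactSupport (Function.uncurry Φ)) {c : ℝ} (hc : 0 < c) (k : ℕ) {h : ℤ × ℤ}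
    (h10 : h.1 ≠ 0) :
    ‖fourier2 Φ (h.1 / c) (h.2 / c)‖ ≤ (|(h.1 : ℝ)| ^ k)⁻¹ *
      (if h.2 = 0 then (c / (2 * π)) ^ k * ∫ t₂, ∫ t₁, ‖iteratedDeriv k (fun s => Φ s t₂) t₁‖
        else (c / (2 * π)) ^ (k + 2) *
          Real.sqrt ((∫ t₂, ∫ t₁, ‖iteratedDeriv (2 * k) (fun s => Φ s t₂) t₁‖) *
            ∫ t₁, ∫ t₂, ‖iteratedDeriv 4 (Φ t₁) t₂‖) * ((h.2 : ℝ) ^ 2)⁻¹) := by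
  set A1 : ℝ := ∫ t₂, ∫ t₁, ‖iteratedDeriv k (fun s => Φ s t₂) t₁‖ with hA1
  set A2 : ℝ := ∫ t₂, ∫ t₁, ‖iteratedDeriv (2 * k) (fun s => Φ s t₂) t₁‖ with hA2
  set A3 : ℝ := ∫ t₁, ∫ t₂, ‖iteratedDeriv 4 (Φ t₁) t₂‖ with hA3
  have hA2n : 0 ≤ A2 := integral_nonneg fun _ => integral_nonneg fun _ => norm_nonneg _
  have hA3n : 0 ≤ A3 := integral_nonneg fun _ => integral_nonneg fun _ => norm_nonneg _
  have h1r : (h.1 : ℝ) ≠ 0 := by exact_mod_cast h10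
  have hξ₁ : (h.1 : ℝ) / c ≠ 0 := div_ne_zero h1r hc.ne'
  have h1a : 0 < |(h.1 : ℝ)| := abs_pos.mpr h1r
  by_cases h2 : h.2 = 0
  · rw [if_pos h2]
    have hb := norm_fourier2_le_left_pow_of_contDiff hΦ hΦc k hξ₁ ((h.2 : ℝ) / c)
    rw [inv_pow_two_pi_abs_div hc h10] at hb
    refine hb.trans (le_of_eq ?_)
    ring
  · rw [if_neg h2]
    have h2r : (h.2 : ℝ) ≠ 0 := by exact_mod_cast h2
    have hξ₂ : (h.2 : ℝ) / c ≠ 0 := div_ne_zero h2r hc.ne'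
    -- the two pure bounds
    have hP₁ := norm_fourier2_le_left_pow_of_contDiff hΦ hΦc (2 * k) hξ₁ ((h.2 : ℝ) / c)
    have hP₂ := norm_fourier2_le_right_pow_of_contDiff hΦ hΦc 4 ((h.1 : ℝ) / c) hξ₂
    rw [inv_pow_two_pi_abs_div hc h10] at hP₁
    rw [inv_pow_two_pi_abs_div hc h2] at hP₂
    -- `min(P₁,P₂) ≤ √(P₁P₂)` (as in the tree's `QuantumLattice.le_sqrt_mul_of_le_of_le`, inlined)
    have hgm : ‖fourier2 Φ (h.1 / c) (h.2 / c)‖ ≤ Real.sqrt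
        (((c / (2 * π)) ^ (2 * k) * (|(h.1 : ℝ)| ^ (2 * k))⁻¹ *
            ∫ t₂, ∫ t₁, ‖iteratedDeriv (2 * k) (fun s => Φ s t₂) t₁‖) *
          ((c / (2 * π)) ^ 4 * (|(h.2 : ℝ)| ^ 4)⁻¹ * ∫ t₁, ∫ t₂, ‖iteratedDeriv 4 (Φ t₁) t₂‖)) :=
      calc ‖fourier2 Φ (h.1 / c) (h.2 / c)‖
          = Real.sqrt (‖fourier2 Φ (h.1 / c) (h.2 / c)‖ * ‖fourier2 Φ (h.1 / c) (h.2 / c)‖) :=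
            (Real.sqrt_mul_self (norm_nonneg _)).symm
        _ ≤ _ := Real.sqrt_le_sqrt (mul_le_mul hP₁ hP₂ (norm_nonneg _) ((norm_nonneg _).trans hP₁))
    refine hgm.trans (le_of_eq ?_)
    -- `√(P₁P₂) = (c/2π)^{k+2} |h₁|^{-k} h₂^{-2} √(A2 A3)`
    have hX : 0 ≤ (c / (2 * π)) ^ (k + 2) * ((|(h.1 : ℝ)| ^ k)⁻¹ * (|(h.2 : ℝ)| ^ 2)⁻¹) := by positivity
    have hprod : (c / (2 * π)) ^ (2 * k) * (|(h.1 : ℝ)| ^ (2 * k))⁻¹ * A2 *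
        ((c / (2 * π)) ^ 4 * (|(h.2 : ℝ)| ^ 4)⁻¹ * A3) =
        ((c / (2 * π)) ^ (k + 2) * ((|(h.1 : ℝ)| ^ k)⁻¹ * (|(h.2 : ℝ)| ^ 2)⁻¹)) ^ 2 * (A2 * A3) := by
      have e1 : (c / (2 * π)) ^ (2 * k) = ((c / (2 * π)) ^ k) ^ 2 := pow_mul' _ _ _
      have e2 : |(h.1 : ℝ)| ^ (2 * k) = (|(h.1 : ℝ)| ^ k) ^ 2 := pow_mul' _ _ _
      have e3 : (c / (2 * π)) ^ 4 = ((c / (2 * π)) ^ 2) ^ 2 := by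
        rw [show (4 : ℕ) = 2 * 2 from rfl, pow_mul]
      have e4 : |(h.2 : ℝ)| ^ 4 = (|(h.2 : ℝ)| ^ 2) ^ 2 := by
        rw [show (4 : ℕ) = 2 * 2 from rfl, pow_mul]
      have e5 : (c / (2 * π)) ^ (k + 2) = (c / (2 * π)) ^ k * (c / (2 * π)) ^ 2 := pow_add _ _ _
      rw [e1, e2, e3, e4, e5]
      ring
    rw [hprod, Real.sqrt_mul (sq_nonneg _), Real.sqrt_sq hX, sq_abs]
    ring

/-- **The `h₁`-tail from pure costs** (finite form): for `c > 0`, `k ≥ 2`, `H ≥ 1`, finite `T ⊆ {|h₁| > H}`: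
`Σ_{h ∈ T} ‖Φ̂(h/c)‖ ≤ 2((c/2π)ᵏA¹_k + (π²/3)(c/2π)^{k+2}√(A¹_{2k}A²₄))·H^{1−k}`. [folklore] -/
theorem sum_tail_norm_fourier2_le_pure (hΦ : ContDiff ℝ ∞ (Function.uncurry Φ))
    (hΦc : HasCompactSupport (Function.uncurry Φ)) {c : ℝ} (hc : 0 < c) {k H : ℕ} (hk : 2 ≤ k)
    (hH : 1 ≤ H) (T : Finset (ℤ × ℤ)) (hT : ∀ h ∈ T, (H : ℤ) < |h.1|) :
    ∑ h ∈ T, ‖fourier2 Φ (h.1 / c) (h.2 / c)‖ ≤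
      2 * ((c / (2 * π)) ^ k * (∫ t₂, ∫ t₁, ‖iteratedDeriv k (fun s => Φ s t₂) t₁‖) +
        π ^ 2 / 3 * ((c / (2 * π)) ^ (k + 2) *
          Real.sqrt ((∫ t₂, ∫ t₁, ‖iteratedDeriv (2 * k) (fun s => Φ s t₂) t₁‖) *
            ∫ t₁, ∫ t₂, ‖iteratedDeriv 4 (Φ t₁) t₂‖))) * ((H : ℝ) ^ (k - 1))⁻¹ := by
  classical
  set U : ℝ := (c / (2 * π)) ^ k * ∫ t₂, ∫ t₁, ‖iteratedDeriv k (fun s => Φ s t₂) t₁‖ with hU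
  set V : ℝ := (c / (2 * π)) ^ (k + 2) *
    Real.sqrt ((∫ t₂, ∫ t₁, ‖iteratedDeriv (2 * k) (fun s => Φ s t₂) t₁‖) *
      ∫ t₁, ∫ t₂, ‖iteratedDeriv 4 (Φ t₁) t₂‖) with hV
  have hU0 : 0 ≤ U := by
    have : 0 ≤ ∫ t₂, ∫ t₁, ‖iteratedDeriv k (fun s => Φ s t₂) t₁‖ :=
      integral_nonneg fun _ => integral_nonneg fun _ => norm_nonneg _
    positivity
  have hV0 : 0 ≤ V := by positivity
  set w : ℤ → ℝ := fun y => if y = 0 then U else V * ((y : ℝ) ^ 2)⁻¹ with hw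
  have hw0 : ∀ y, 0 ≤ w y := fun y => by rw [hw]; dsimp only; split_ifs <;> positivity
  have hwsum : ∀ S : Finset ℤ, ∑ y ∈ S, w y ≤ U + V * (π ^ 2 / 3) := by
    intro S
    have hsplit : ∀ y, w y = (if y = 0 then U else 0) +
        V * (if y = 0 then (0 : ℝ) else ((y : ℝ) ^ 2)⁻¹) := by
      intro y; rw [hw]; dsimp only; split_ifs <;> ring
    rw [Finset.sum_congr rfl fun y _ => hsplit y, Finset.sum_add_distrib, ← Finset.mul_sum,
      Finset.sum_ite_eq' S (0 : ℤ) (fun _ => U)]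
    refine add_le_add ?_ (mul_le_mul_of_nonneg_left (sum_inv_sq_int_le S) hV0)
    split_ifs
    · exact le_rfl
    · exact hU0
  have hT0 : ∀ h ∈ T, h.1 ≠ 0 := by
    intro h hh e
    have := hT h hh
    rw [e, abs_zero] at this
    omega
  set S₁ : Finset ℤ := T.image Prod.fst
  set S₂ : Finset ℤ := T.image Prod.snd
  have hsub : T ⊆ S₁ ×ˢ S₂ := fun h hh =>
    Finset.mem_product.mpr ⟨Finset.mem_image_of_mem _ hh, Finset.mem_image_of_mem _ hh⟩
  have hS₁' : ∀ x ∈ S₁, (H : ℤ) < |x| := by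
    intro x hx
    obtain ⟨h, hh, rfl⟩ := Finset.mem_image.mp hx
    exact hT h hh
  calc ∑ h ∈ T, ‖fourier2 Φ (h.1 / c) (h.2 / c)‖
      ≤ ∑ h ∈ T, (|(h.1 : ℝ)| ^ k)⁻¹ * w h.2 := by
        refine Finset.sum_le_sum fun h hh => ?_
        refine (norm_fourier2_lattice_le_pure hΦ hΦc hc k (hT0 h hh)).trans (le_of_eq ?_)
        rw [hw]
    _ ≤ ∑ h ∈ S₁ ×ˢ S₂, (|(h.1 : ℝ)| ^ k)⁻¹ * w h.2 :=
        Finset.sum_le_sum_of_subset_of_nonneg hsub fun h _ _ => mul_nonneg (by positivity) (hw0 _)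
    _ = ∑ x ∈ S₁, (|(x : ℝ)| ^ k)⁻¹ * ∑ y ∈ S₂, w y := by
        rw [Finset.sum_product]
        exact Finset.sum_congr rfl fun x _ => by rw [Finset.mul_sum]
    _ ≤ ∑ x ∈ S₁, (|(x : ℝ)| ^ k)⁻¹ * (U + V * (π ^ 2 / 3)) :=
        Finset.sum_le_sum fun x _ => mul_le_mul_of_nonneg_left (hwsum S₂) (by positivity)
    _ = (U + V * (π ^ 2 / 3)) * ∑ x ∈ S₁, (|(x : ℝ)| ^ k)⁻¹ := by
        rw [Finset.mul_sum]; exact Finset.sum_congr rfl fun x _ => by ring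
    _ ≤ (U + V * (π ^ 2 / 3)) * (2 * ((H : ℝ) ^ (k - 1))⁻¹) :=
        mul_le_mul_of_nonneg_left (sum_inv_pow_abs_int_le hk hH S₁ hS₁') (by positivity)
    _ = _ := by ring

/-- **The `h₁`-tail from pure costs** (series form). [folklore] -/
theorem tsum_tail_norm_fourier2_le_pure (hΦ : ContDiff ℝ ∞ (Function.uncurry Φ))
    (hΦc : HasCompactSupport (Function.uncurry Φ)) {c : ℝ} (hc : 0 < c) {k H : ℕ} (hk : 2 ≤ k)
    (hH : 1 ≤ H) :
    ∑' h : ℤ × ℤ, (if (H : ℤ) < |h.1| then ‖fourier2 Φ (h.1 / c) (h.2 / c)‖ else 0) ≤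
      2 * ((c / (2 * π)) ^ k * (∫ t₂, ∫ t₁, ‖iteratedDeriv k (fun s => Φ s t₂) t₁‖) +
        π ^ 2 / 3 * ((c / (2 * π)) ^ (k + 2) *
          Real.sqrt ((∫ t₂, ∫ t₁, ‖iteratedDeriv (2 * k) (fun s => Φ s t₂) t₁‖) *
            ∫ t₁, ∫ t₂, ‖iteratedDeriv 4 (Φ t₁) t₂‖))) * ((H : ℝ) ^ (k - 1))⁻¹ := by
  classical
  refine Real.tsum_le_of_sum_le (fun h => by split_ifs <;> positivity) fun T => ?_
  rw [← Finset.sum_filter]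
  exact sum_tail_norm_fourier2_le_pure hΦ hΦc hc hk hH _ fun h hh => (Finset.mem_filter.mp hh).2

/-- **Truncation from PURE derivative costs.** For `uncurry Φ` smooth of compact support, `c > 0`, `k ≥ 2`,
costs `A¹_k ≤ S₁D₁ᵏ`, `A¹_{2k} ≤ S₁'D₁^{2k}`, `A²₄ ≤ S₂D₂⁴` (`S₁, S₁', D₁ ≥ 0`), a loss `Q ≥ 1` and a truncation point
`H ≥ max(1, cD₁Q/(2π))`:
`Σ_{|h₁| > H} ‖Φ̂(h/c)‖ ≤ 2·(S₁ + (π²/3)·(cD₂/(2π))²·√(S₁'S₂))·H·Q^{−k}`. [folklore] -/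
theorem tsum_tail_norm_fourier2_le_pure_of_cost (hΦ : ContDiff ℝ ∞ (Function.uncurry Φ))
    (hΦc : HasCompactSupport (Function.uncurry Φ)) {c : ℝ} (hc : 0 < c) {k H : ℕ} (hk : 2 ≤ k)
    (hH : 1 ≤ H) {S₁ S₁' S₂ D₁ D₂ Q : ℝ} (hS₁ : 0 ≤ S₁) (hS₁' : 0 ≤ S₁') (hD₁ : 0 ≤ D₁) (hQ : 1 ≤ Q)
    (hA₁ : (∫ t₂, ∫ t₁, ‖iteratedDeriv k (fun s => Φ s t₂) t₁‖) ≤ S₁ * D₁ ^ k)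
    (hA₁' : (∫ t₂, ∫ t₁, ‖iteratedDeriv (2 * k) (fun s => Φ s t₂) t₁‖) ≤ S₁' * D₁ ^ (2 * k))
    (hA₂ : (∫ t₁, ∫ t₂, ‖iteratedDeriv 4 (Φ t₁) t₂‖) ≤ S₂ * D₂ ^ 4)
    (hlen : c * D₁ / (2 * π) * Q ≤ H) :
    ∑' h : ℤ × ℤ, (if (H : ℤ) < |h.1| then ‖fourier2 Φ (h.1 / c) (h.2 / c)‖ else 0) ≤
      2 * (S₁ + π ^ 2 / 3 * (c * D₂ / (2 * π)) ^ 2 * Real.sqrt (S₁' * S₂)) * H * (Q ^ k)⁻¹ := by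
  have htail := tsum_tail_norm_fourier2_le_pure hΦ hΦc hc hk hH
  have hlen' := pow_mul_pow_inv_le_of_dualLength hc hD₁ hQ hH (by omega : 1 ≤ k) hlen
  have hA2n : 0 ≤ ∫ t₂, ∫ t₁, ‖iteratedDeriv (2 * k) (fun s => Φ s t₂) t₁‖ :=
    integral_nonneg fun _ => integral_nonneg fun _ => norm_nonneg _
  -- `√(A¹_{2k} A²₄) ≤ √(S₁'S₂)·D₁^k·D₂²`
  have hsqrt : Real.sqrt ((∫ t₂, ∫ t₁, ‖iteratedDeriv (2 * k) (fun s => Φ s t₂) t₁‖) *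
      ∫ t₁, ∫ t₂, ‖iteratedDeriv 4 (Φ t₁) t₂‖) ≤ Real.sqrt (S₁' * S₂) * (D₁ ^ k * D₂ ^ 2) := by
    have h1 : (∫ t₂, ∫ t₁, ‖iteratedDeriv (2 * k) (fun s => Φ s t₂) t₁‖) *
        (∫ t₁, ∫ t₂, ‖iteratedDeriv 4 (Φ t₁) t₂‖) ≤ (S₁' * S₂) * (D₁ ^ k * D₂ ^ 2) ^ 2 := by
      calc _ ≤ (S₁' * D₁ ^ (2 * k)) * (S₂ * D₂ ^ 4) := mul_le_mul hA₁' hA₂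
              (integral_nonneg fun _ => integral_nonneg fun _ => norm_nonneg _) (by positivity)
        _ = (S₁' * S₂) * (D₁ ^ k * D₂ ^ 2) ^ 2 := by
            have e1 : D₁ ^ (2 * k) = (D₁ ^ k) ^ 2 := pow_mul' _ _ _
            have e2 : D₂ ^ 4 = (D₂ ^ 2) ^ 2 := by rw [show (4 : ℕ) = 2 * 2 from rfl, pow_mul]
            rw [e1, e2]; ring
    calc _ ≤ Real.sqrt ((S₁' * S₂) * (D₁ ^ k * D₂ ^ 2) ^ 2) := Real.sqrt_le_sqrt h1
      _ = Real.sqrt (S₁' * S₂) * (D₁ ^ k * D₂ ^ 2) := by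
          rw [Real.sqrt_mul' _ (sq_nonneg _), Real.sqrt_sq (by positivity)]
  -- assemble
  have hmid : (c / (2 * π)) ^ k * (∫ t₂, ∫ t₁, ‖iteratedDeriv k (fun s => Φ s t₂) t₁‖) +
      π ^ 2 / 3 * ((c / (2 * π)) ^ (k + 2) *
        Real.sqrt ((∫ t₂, ∫ t₁, ‖iteratedDeriv (2 * k) (fun s => Φ s t₂) t₁‖) *
          ∫ t₁, ∫ t₂, ‖iteratedDeriv 4 (Φ t₁) t₂‖)) ≤
      ((c / (2 * π)) ^ k * D₁ ^ k) * (S₁ + π ^ 2 / 3 * (c * D₂ / (2 * π)) ^ 2 * Real.sqrt (S₁' * S₂)) := by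
    have e1 : (c / (2 * π)) ^ k * (∫ t₂, ∫ t₁, ‖iteratedDeriv k (fun s => Φ s t₂) t₁‖) ≤
        (c / (2 * π)) ^ k * (S₁ * D₁ ^ k) := mul_le_mul_of_nonneg_left hA₁ (by positivity)
    have e2 : (c / (2 * π)) ^ (k + 2) *
        Real.sqrt ((∫ t₂, ∫ t₁, ‖iteratedDeriv (2 * k) (fun s => Φ s t₂) t₁‖) *
          ∫ t₁, ∫ t₂, ‖iteratedDeriv 4 (Φ t₁) t₂‖) ≤
        (c / (2 * π)) ^ (k + 2) * (Real.sqrt (S₁' * S₂) * (D₁ ^ k * D₂ ^ 2)) :=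
      mul_le_mul_of_nonneg_left hsqrt (by positivity)
    have e3 : (c / (2 * π)) ^ (k + 2) * (Real.sqrt (S₁' * S₂) * (D₁ ^ k * D₂ ^ 2)) =
        ((c / (2 * π)) ^ k * D₁ ^ k) * ((c * D₂ / (2 * π)) ^ 2 * Real.sqrt (S₁' * S₂)) := by
      rw [pow_add]; ring
    have hπ3 : (0 : ℝ) ≤ π ^ 2 / 3 := by positivity
    nlinarith [e1, mul_le_mul_of_nonneg_left (e2.trans (le_of_eq e3)) hπ3]
  have hK0 : 0 ≤ S₁ + π ^ 2 / 3 * (c * D₂ / (2 * π)) ^ 2 * Real.sqrt (S₁' * S₂) := by positivity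
  calc _ ≤ 2 * ((c / (2 * π)) ^ k * (∫ t₂, ∫ t₁, ‖iteratedDeriv k (fun s => Φ s t₂) t₁‖) +
        π ^ 2 / 3 * ((c / (2 * π)) ^ (k + 2) *
          Real.sqrt ((∫ t₂, ∫ t₁, ‖iteratedDeriv (2 * k) (fun s => Φ s t₂) t₁‖) *
            ∫ t₁, ∫ t₂, ‖iteratedDeriv 4 (Φ t₁) t₂‖))) * ((H : ℝ) ^ (k - 1))⁻¹ := htail
    _ ≤ 2 * (((c / (2 * π)) ^ k * D₁ ^ k) *
          (S₁ + π ^ 2 / 3 * (c * D₂ / (2 * π)) ^ 2 * Real.sqrt (S₁' * S₂))) * ((H : ℝ) ^ (k - 1))⁻¹ := by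
        gcongr
    _ = 2 * (S₁ + π ^ 2 / 3 * (c * D₂ / (2 * π)) ^ 2 * Real.sqrt (S₁' * S₂)) *
          ((c / (2 * π)) ^ k * D₁ ^ k * ((H : ℝ) ^ (k - 1))⁻¹) := by ring
    _ ≤ 2 * (S₁ + π ^ 2 / 3 * (c * D₂ / (2 * π)) ^ 2 * Real.sqrt (S₁' * S₂)) * ((H : ℝ) * (Q ^ k)⁻¹) :=
        mul_le_mul_of_nonneg_left hlen' (by positivity)
    _ = _ := by ring

end Pure

end Summit.Parity.GeneralizedHardyLittlewood.Theorems.BeyondDiagonalBeatsQuarter.OffDiagPoissonTwisted
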